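import Summits.HodgeConjecture.HodgeConjecture.Theorems.F0LD2ThetaTensorCLM
import Summits.HodgeConjecture.HodgeConjecture.Theorems.F0LD2ThetaKcInvariance
import Literature.NumberTheory.Automorphic.Liu2021.Def411WeilCarriersArchPlaceOperator
import Literature.NumberTheory.Automorphic.Liu2021.Def411WeilCarriersArchPlaceSign
import Literature.NumberTheory.Automorphic.Liu2021.ThetaLiftFromLineArchTypes
import Literature.NumberTheory.GelbartRogawski1991.DoubledWeilRepresentationArchPlacePhaseNeg
import Literature.NumberTheory.GelbartRogawski1991.DoubledWeilRepresentationArchPlaceHermite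
import Literature.NumberTheory.GelbartRogawski1991.ArchLocalUnitarySurjective
import Literature.NumberTheory.GelbartRogawski1991.QuadExtSplittingCharArchType
import Literature.NumberTheory.Weil1964.ArchPlaceCovariantVanishing
import Literature.NumberTheory.Automorphic.IdeleClassBaseChangePosReal
import Literature.NumberTheory.Automorphic.IdeleClassCharacterHecke
import Literature.NumberTheory.Automorphic.ConjugateSelfDualInfinityType
import HarnessLib

-- As in the lineage (★ `F0P2oCcThetaFunctionalCovariance`): large statements over the theta-kernel datum; elaborate sequentially.
set_option Elab.async false
/-!
# Crux `HLiu418`, line LD2, organ C₂away — THE CORE at a definite place: the projected theta functional of a holomorphic-cotangent `P` is COVARIANT on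
# box vectors under `U(V_{w₀})` (`w₀ ≠ w₁`) and VANISHES on pure tensors when the archimedean exponent at `w₀` is wrong — rank 2, cone model at `w₁`,
# PINNED transport under the scaled frame ([Liu2021, App. D Lem. D.2 (1)]; the `n = 3` core is ★ `F0P2oCcThetaFunctionalCovariance`)

Cell hodgecm-mathlib (D-0151), FLOOR 0; crux item `HLiu418` = stmt-HodgeConjecture-24832; half-A line LD2 (socket 27458 `F0_AlbCm.lean`, stub `stub_S1b_facts` =
letter #74), organ C₂away `ArchTypeAway₂` of LD2-plan (g0)'s skeleton (ED. 5 e8da573259aec245 :358–:396).  Seat LA1-p01 (g2).  THEOREMS ONLY (no `def`, no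
instance, no notation, no named fact, no `sorry`); `--supports stmt-HodgeConjecture-24832`.  HC_CM is proved only modulo the 7 printed citations (2 remaining:
hLiu418 = stmt-HodgeConjecture-24832, h413 = stmt-HodgeConjecture-24833) until rung 0 closes; this file discharges nothing printed — it is the analytic core of
the organ's closer `Theorems/F0LD2ArchTypeAway` (head `archTypeAway₂_holds`).

WHAT = ★ `F0P2oCcThetaFunctionalCovariance` (A-p19 (g19), n = 3, ball model, literal `cmAdelicFrameTransport`) PORTED «ball ↦ cone, `cmAdelicFrameTransport` ↦
pinned `ιA`, `3 ↦ 2`», every transport-dependent input now ★ at rank 2 ∕ abstract `ιA` (★ `F0LD1ThetaTransportKit` LD1-p01 (g0); ★ `F0LD2ThetaTensorClasses`,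
★ `F0LD2CurveHolTestVector`, ★ `F0LD2FrameTransportPin` LD2-p02 (g0); ★ `F0LD2ThetaTensorCLM`, ★ `F0LD2ThetaKcInvariance` LA1-p01 (g2)) and every
archimedean brick rank-generic ★.  SETTING: `P` a discrete automorphic representation of `U(H)` containing the NON-ZERO class of a holomorphic cotangent
form `fh ∈ holCotForms₂ … 𝔣` at the complex place `w₁` (★ `UnitaryCurveForms`); `w₀ = cmPlaceOver L v₀ ≠ w₁`; the theta lift of the line `⟨a⟩` at the
`μ`-splitting read along `ιA` (`hιA : Continuous ιA ∧ rational ↦ rational`, `hpin : ↑(ιA k) = g_𝔸⁻¹ k g_𝔸`, frame `formCongr c g (t • H) = diag dV`).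
* `starProjection_toLp_lineThetaLift_tmul_of_box₂` — `U(V_{w₀})`-invariance (★ `F0LD2ThetaKcInvariance.starProjection_toLp_lineThetaLift_pairRep_adelicSingle₂`)
  ∘ read-back ★ T2 `pairRep_chiSplittingLine_adelicSingle_tmul_of_box` ∘ homogeneity ★ `F0LD2ThetaTensorClasses.toLp_lineThetaLift_smul_left`:
  `pr_P [Θ̃_{E(a₁′ ⊗ Φ_f)}] = (η·c)⁻¹ • pr_P [Θ̃_{E(a₁ ⊗ Φ_f)}]` under the box hypothesis `hS`;
* `starProjection_toLp_lineThetaLift_tmul_eq_zero_of_pos₂ ∕ _of_neg₂` — if `(τ_{w₀} ± 1)/2 ≠ 0` then `pr_P [Θ̃_{E(φ ⊗ Φ_f)}(f) ∘ ιA] = 0` for all `φ`, `Φ_f`,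
  MODULO the two inputs `hS1` (★ S1 `exists_archLocal_entries_eq_of_pos ∕ _of_neg`) and `hβII` (★ β-II
  `carrierConjEquiv_frameD_placeBlock_mulSingle_doubled_archBoxTensor`) taken as HYPOTHESES exactly as at `n = 3` (the head discharges them).  Assembly: ★ T3
  `F0LD2ThetaTensorCLM.exists_clm_comp_toLp_lineThetaLift_tmul` CLM; ★ β-I± `exists_sectionD_archKPlace_apply_of_pos ∕ _of_neg` + `hβII` ⇒ `hS` on the Hermite
  basis with `c = vac`; ★ (G) `etaD_mul_vac_archKPlace_of_pos ∕ _of_neg` scalar `η·vac = (det u)^{(τ±1)/2}`; ★ S2 `det_eq_star_pow_of_entries ∕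
  det_eq_pow_of_entries`; `hS1`; ★ δ `eq_zero_of_forall_unitaryOpPi_placeBlock_mulSingle_hermitePi` kills `T ∘ frameV⁻¹` (`Nontrivial (Fin n′)` from `n′ = 2`).

References: [Liu2021] Y. Liu, Camb. J. Math. 9 (2021), proof of Prop. 4.13 Case 1 (l. 2137–2141, p. 48), App. D Lem. D.2 (1) (p. 127, l. 5283);
[GelbartRogawski1991] Invent. Math. 105 (1991), §3.1 Prop. 3.1.1 p. 455; [KonnoKonno2007] Kyushu J. Math. 61 (2007), Thm. 5.4, Lemma 5.2; [Folland1989]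
Prop. (4.39), (4.76); [BorelJacquet1979] PSPM 33.1 (1979), §4.1, §4.6.
-/

set_option autoImplicit false
-- the mandated namespace has the single-problem summit's repeated segment (`HodgeConjecture.HodgeConjecture`)
set_option linter.dupNamespace false

noncomputable section
open NumberField NumberField.InfinitePlace MeasureTheory IsDedekindDomain
open scoped Matrix ComplexOrder ENNReal TensorProduct SchwartzMap Kronecker Classical

namespace Summit.HodgeConjecture.HodgeConjecture.Cruxes.HLiu418.F0LD2ArchTypeAwayCore

open _root_.MeasureTheory
open Literature.NumberTheory.Automorphic Literature.NumberTheory.Automorphic.UnitaryGroup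
open Literature.NumberTheory.Automorphic.UnitaryGroup.CotangentForms
open Literature.NumberTheory.Automorphic.UnitaryCurveForms
open Literature.NumberTheory.Automorphic.IdeleClassGroup Literature.NumberTheory.Automorphic.Liu2021
open Literature.NumberTheory.Automorphic.Liu2021.Def411WeilCarriers Literature.NumberTheory.Automorphic.Liu2021.Def411WeilCarriersDoubling
open Literature.NumberTheory.GelbartRogawski1991 Literature.NumberTheory.GelbartRogawski1991.UnitaryDualPair Literature.NumberTheory.GelbartRogawski1991.GRConstruction
open Literature.NumberTheory.Weil1964 Literature.RepresentationTheory.Liu2021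
open Literature.RepresentationTheory.HeisenbergGroup Literature.Analysis.SegalBargmann Literature.RepresentationTheory.KonnoKonno2007
open Literature.RepresentationTheory.CompactGroups
section Core
variable (L : Type) [Field L] [NumberField L] [IsCMField L] (H : Matrix (Fin 2) (Fin 2) L)
  {n' : ℕ} (e₁ : Fin 2 × Fin 1 ≃ Fin n') (dV : Fin 2 → L) (hdV : ∀ i, IsCMField.complexConj L (dV i) = dV i)
  (hdV0 : ∀ i, dV i ≠ 0) (t : L) (ht : t ≠ 0) (g : GL (Fin 2) L)
  (hg : formCongr ((IsCMField.complexConj L : L ≃ₐ[↥(maximalRealSubfield L)] L) : L →+* L) g (t • H) = Matrix.diagonal dV)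
  (ιA : (adelicGroupData (↥(maximalRealSubfield L)) L (IsCMField.complexConj L) 2 H).Adelic →* ↥(UnitaryGroup.adelic (↥(maximalRealSubfield L)) L (IsCMField.complexConj L) 2 (Matrix.diagonal dV)))
  (hιA : Continuous ιA ∧ ∀ ⦃γ : (adelicGroupData (↥(maximalRealSubfield L)) L (IsCMField.complexConj L) 2 H).Adelic⦄,
    γ ∈ (UnitaryGroup.toAdelic (↥(maximalRealSubfield L)) L (IsCMField.complexConj L) 2 H).range →
      ιA γ ∈ (UnitaryGroup.toAdelic (↥(maximalRealSubfield L)) L (IsCMField.complexConj L) 2 (Matrix.diagonal dV)).range)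
  (hpin : ∀ k, ((ιA k : ↥(UnitaryGroup.adelic (↥(maximalRealSubfield L)) L (IsCMField.complexConj L) 2 (Matrix.diagonal dV))) :
      GL (Fin 2) (AdeleRing (𝓞 L) L)) =
    (toAdeleGL L g)⁻¹ * adelicVal (↥(maximalRealSubfield L)) L (IsCMField.complexConj L) 2 H k * toAdeleGL L g)
  (μ : Literature.NumberTheory.Automorphic.IdeleClassGroup L →ₜ* Circle) (hμ : IsConjugateSymplectic L μ) (a : (↥(maximalRealSubfield L))ˣ)
  (hρ : HasThetaMajorants fun
      (p : ↥(UnitaryGroup.adelic (↥(maximalRealSubfield L)) L (IsCMField.complexConj L) 2 (Matrix.diagonal dV)) × ↥(UnitaryGroup.adelic (↥(maximalRealSubfield L)) L (IsCMField.complexConj L) 1 (JW (↥(maximalRealSubfield L)) L a))) (Φ : piSchwartzBruhat (↥(maximalRealSubfield L)) (Fin n')) =>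
        pairRep (↥(maximalRealSubfield L)) L (IsCMField.complexConj L) 2 1 e₁ (Matrix.diagonal dV) (JW (↥(maximalRealSubfield L)) L a)
          (chiSplittingLine L e₁ dV hdV hdV0 (toHeckeCharacter L μ) (isUnitary_toHeckeCharacter L μ)
            ((isOscillatorChar_toHeckeCharacter_iff μ).mpr hμ) (TW (↥(maximalRealSubfield L)) a)
            (isUnit_det_TW (↥(maximalRealSubfield L)) a) (JW (↥(maximalRealSubfield L)) L a) (JW_eq (↥(maximalRealSubfield L)) L a))
          p Φ)
  [CompactSpace (↥(UnitaryGroup.adelic (↥(maximalRealSubfield L)) L (IsCMField.complexConj L) 2 (Matrix.diagonal dV)) ⧸ (UnitaryGroup.toAdelic (↥(maximalRealSubfield L)) L (IsCMField.complexConj L) 2 (Matrix.diagonal dV)).range)] [MeasurableSpace (↥(UnitaryGroup.adelic (↥(maximalRealSubfield L)) L (IsCMField.complexConj L) 1 (JW (↥(maximalRealSubfield L)) L a)) ⧸ (UnitaryGroup.toAdelic (↥(maximalRealSubfield L)) L (IsCMField.complexConj L) 1 (JW (↥(maximalRealSubfield L)) L a)).range)] [BorelSpace (↥(UnitaryGroup.adelic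 (↥(maximalRealSubfield L)) L (IsCMField.complexConj L) 1 (JW (↥(maximalRealSubfield L)) L a)) ⧸ (UnitaryGroup.toAdelic (↥(maximalRealSubfield L)) L (IsCMField.complexConj L) 1 (JW (↥(maximalRealSubfield L)) L a)).range)] (μW : Measure (↥(UnitaryGroup.adelic (↥(maximalRealSubfield L)) L (IsCMField.complexConj L) 1 (JW (↥(maximalRealSubfield L)) L a)) ⧸ (UnitaryGroup.toAdelic (↥(maximalRealSubfield L)) L (IsCMField.complexConj L) 1 (JW (↥(maximalRealSubfield L)) L a)).range)) [IsFiniteMeasure μW]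
  (f : C((↥(UnitaryGroup.adelic (↥(maximalRealSubfield L)) L (IsCMField.complexConj L) 1 (JW (↥(maximalRealSubfield L)) L a)) ⧸ (UnitaryGroup.toAdelic (↥(maximalRealSubfield L)) L (IsCMField.complexConj L) 1 (JW (↥(maximalRealSubfield L)) L a)).range), ℂ))
  (w₁ : {w : InfinitePlace L // w.IsComplex}) (𝔣 : ConeFrame L H w₁)
  {μA : Measure (adelicGroupData (↥(maximalRealSubfield L)) L (IsCMField.complexConj L) 2 H).automorphicQuotient}
  [(adelicGroupData (↥(maximalRealSubfield L)) L (IsCMField.complexConj L) 2 H).IsAutomorphicMeasure μA]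
  [CompactSpace (adelicGroupData (↥(maximalRealSubfield L)) L (IsCMField.complexConj L) 2 H).automorphicQuotient]
  (P : DiscreteAutomorphicRep (adelicGroupData (↥(maximalRealSubfield L)) L (IsCMField.complexConj L) 2 H) μA)
  {fh : (adelicGroupData (↥(maximalRealSubfield L)) L (IsCMField.complexConj L) 2 H).Adelic → ℂ}
  (hfh : fh ∈ holCotForms₂ (↥(maximalRealSubfield L)) L (IsCMField.complexConj L) H (IsCMField.complexConj_ne_one L)
    (UnitaryGroup.complexConj_smul_infinitePlace L) w₁ 𝔣)
  (hj : MemLp (toQuotFun (adelicGroupData (↥(maximalRealSubfield L)) L (IsCMField.complexConj L) 2 H) fh) 2 μA)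
  (hjmem : hj.toLp _ ∈ P.space.toSubmodule) (hjne : hj.toLp _ ≠ 0)
  (v₀ : {v : InfinitePlace (↥(maximalRealSubfield L)) // v.IsReal})

include ht hg hpin hfh hjmem hjne in
/-- **COVARIANCE OF THE PROJECTED THETA FUNCTIONAL ON BOX VECTORS** at a definite place `w₀ = cmPlaceOver L v₀ ≠ w(ι)`: if Folland's section of
`k_{v₀,u}`, read in the doubled frame, moves the box vector `R_{e₂}(a₁ ⊠ a₂)` to `c • R_{e₂}(a₁′ ⊠ a₂)` (`a₂ ⊗ f₂ ≠ 0`, `c ≠ 0`), then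
`pr_P [Θ̃_{E(a₁′ ⊗ Φ_f)}(f) ∘ ιA] = (η_τ(k_{v₀,u}) · c)⁻¹ • pr_P [Θ̃_{E(a₁ ⊗ Φ_f)}(f) ∘ ιA]` (★ α invariance + ★ T2 read-back + ★ homogeneity).
[cite: Liu2021, proof of Prop. 4.13 Case 1 (l. 2137–2141, p. 48); App. D Lem. D.2 (1)] [cite: GelbartRogawski1991, §3.1 Prop. 3.1.1 p. 455]
[cite: BorelJacquet1979, §4.6] -/
theorem starProjection_toLp_lineThetaLift_tmul_of_box₂ (hw₀ : cmPlaceOver L v₀ ≠ w₁)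
    {τ : InfinitePlace L → ℤ} (hτ : (toHeckeCharacter L μ).HasUnitaryArchType τ 0) (hodd : ∀ w, Odd (τ w))
    (u : UnitaryGroup.archLocal L 2 (Matrix.diagonal dV) (cmPlaceOver L v₀))
    {a₁ a₁' a₂ : 𝓢((Fin n' → mixedEmbedding.mixedSpace ↥(maximalRealSubfield L)), ℂ)} {c : ℂ} (hc : c ≠ 0)
    (hS : carrierConjEquiv (frameD L e₁ dV hdV hdV0 (lineW L (TW (↥(maximalRealSubfield L)) a)) (complexConj_lineW L (TW (↥(maximalRealSubfield L)) a))
          (lineW_ne_zero L (TW (↥(maximalRealSubfield L)) a) (isUnit_det_TW (↥(maximalRealSubfield L)) a)))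
        (sectionD L e₁ dV hdV hdV0 (lineW L (TW (↥(maximalRealSubfield L)) a)) (complexConj_lineW L (TW (↥(maximalRealSubfield L)) a))
          (lineW_ne_zero L (TW (↥(maximalRealSubfield L)) a) (isUnit_det_TW (↥(maximalRealSubfield L)) a))
          (archKPlace L e₁ dV hdV (lineW L (TW (↥(maximalRealSubfield L)) a)) (complexConj_lineW L (TW (↥(maximalRealSubfield L)) a)) v₀ u)).1.2
          (schwartzReindexCLM (↥(maximalRealSubfield L)) (e₂ (n := n')) (archBoxTensor a₁ a₂)) =
      c • schwartzReindexCLM (↥(maximalRealSubfield L)) (e₂ (n := n')) (archBoxTensor a₁' a₂))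
    (Φf : FinSB (↥(maximalRealSubfield L)) (Fin n')) {f₂ : FinSB (↥(maximalRealSubfield L)) (Fin n')}
    (hne : piSchwartzBruhatEquiv (↥(maximalRealSubfield L)) (Fin n') (a₂ ⊗ₜ f₂) ≠ 0) :
    P.space.toSubmodule.starProjection
        (MemLp.toLp _ (F0LD1ThetaTransportKit.memLp_toQuotFun_lineThetaLift L 2 H e₁ dV hdV hdV0 ιA hιA μ hμ a hρ μW
          (piSchwartzBruhatEquiv (↥(maximalRealSubfield L)) (Fin n') (a₁' ⊗ₜ Φf)) f μA 2)) =
      ((((etaD L e₁ dV hdV (lineW L (TW (↥(maximalRealSubfield L)) a)) (complexConj_lineW L (TW (↥(maximalRealSubfield L)) a)) τ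
            (archKPlace L e₁ dV hdV (lineW L (TW (↥(maximalRealSubfield L)) a)) (complexConj_lineW L (TW (↥(maximalRealSubfield L)) a)) v₀ u) : ℂˣ) : ℂ)) *
          c)⁻¹ •
        P.space.toSubmodule.starProjection
          (MemLp.toLp _ (F0LD1ThetaTransportKit.memLp_toQuotFun_lineThetaLift L 2 H e₁ dV hdV hdV0 ιA hιA μ hμ a hρ μW
            (piSchwartzBruhatEquiv (↥(maximalRealSubfield L)) (Fin n') (a₁ ⊗ₜ Φf)) f μA 2)) := by
  have hα := F0LD2ThetaKcInvariance.starProjection_toLp_lineThetaLift_pairRep_adelicSingle₂ L H e₁ dV hdV hdV0 t ht g hg ιA hιA hpin μ hμ a hρ μW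
    (piSchwartzBruhatEquiv (↥(maximalRealSubfield L)) (Fin n') (a₁ ⊗ₜ Φf)) f w₁ 𝔣 P hfh hj hjmem hjne (cmPlaceOver L v₀) hw₀ u
  have hT2 := pairRep_chiSplittingLine_adelicSingle_tmul_of_box L dV hdV hdV0 v₀ e₁ (isUnitary_toHeckeCharacter L μ)
    ((isOscillatorChar_toHeckeCharacter_iff μ).mpr hμ) hτ hodd (TW (↥(maximalRealSubfield L)) a) (isUnit_det_TW (↥(maximalRealSubfield L)) a)
    (JW (↥(maximalRealSubfield L)) L a) (JW_eq (↥(maximalRealSubfield L)) L a) u hS Φf hne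
  rw [F0LD2ThetaTensorClasses.toLp_lineThetaLift_congr L 2 H e₁ dV hdV hdV0 ιA hιA μ hμ a hρ μW f μA hT2,
    F0LD2ThetaTensorClasses.toLp_lineThetaLift_smul_left L 2 H e₁ dV hdV hdV0 ιA hιA μ hμ a hρ μW f μA, map_smul] at hα
  have hz : ((((etaD L e₁ dV hdV (lineW L (TW (↥(maximalRealSubfield L)) a)) (complexConj_lineW L (TW (↥(maximalRealSubfield L)) a)) τ
      (archKPlace L e₁ dV hdV (lineW L (TW (↥(maximalRealSubfield L)) a)) (complexConj_lineW L (TW (↥(maximalRealSubfield L)) a)) v₀ u) : ℂˣ) : ℂ)) *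
        c) ≠ 0 := mul_ne_zero (Units.ne_zero _) hc
  rw [← hα, smul_smul, inv_mul_cancel₀ hz, one_smul]

include ht hg hpin hfh hjmem hjne in
set_option maxHeartbeats 1600000 in -- (as ★ n = 3: the telescope of ★ α ∕ ★ T3 is large; the rewrites are cheap but numerous)
/-- **THE PROJECTED THETA FUNCTIONAL VANISHES ON PURE TENSORS WHEN THE ARCHIMEDEAN EXPONENT IS WRONG, pair form POSITIVE at `v₀`**
(`w₀ = cmPlaceOver L v₀ ≠ w(ι)`, `(τ_{w₀}+1)/2 ≠ 0`; modulo `hS1`, `hβII` — see the module docstring).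
[cite: Liu2021, proof of Prop. 4.13 Case 1 (l. 2137–2141, p. 48); App. D Lem. D.2 (1)] [cite: KonnoKonno2007, Thm. 5.4, Lemma 5.2] [cite: Folland1989, Prop. (4.76)] -/
theorem starProjection_toLp_lineThetaLift_tmul_eq_zero_of_pos₂ (hw₀ : cmPlaceOver L v₀ ≠ w₁)
    {τ : InfinitePlace L → ℤ} (hτ : (toHeckeCharacter L μ).HasUnitaryArchType τ 0) (hodd : ∀ w, Odd (τ w))
    (hpos : ∀ k : Fin n', 0 < signVec (cmPlaceOver L) (cmGramEntry L e₁ dV hdV (lineW L (TW (↥(maximalRealSubfield L)) a))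
      (complexConj_lineW L (TW (↥(maximalRealSubfield L)) a))) (imagUnit L) v₀ k)
    (hm : (τ (cmPlaceOver L v₀).1 + 1) / 2 ≠ 0)
    (hS1 : ∀ A : Matrix.unitaryGroup (Fin n') ℂ, ∃ u : UnitaryGroup.archLocal L 2 (Matrix.diagonal dV) (cmPlaceOver L v₀),
      ∀ i i' : Fin n', star ((((sqrtAbs (signVec (cmPlaceOver L) (cmGramEntry L e₁ dV hdV (lineW L (TW (↥(maximalRealSubfield L)) a))
          (complexConj_lineW L (TW (↥(maximalRealSubfield L)) a))) (imagUnit L) v₀) i : ℝ) : ℂ)) *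
        Matrix.reindex e₁ e₁
          ((((u : UnitaryGroup.archLocal L 2 (Matrix.diagonal dV) (cmPlaceOver L v₀)) : GL (Fin 2) ℂ) : Matrix (Fin 2) (Fin 2) ℂ) ⊗ₖ
            (1 : Matrix (Fin 1) (Fin 1) ℂ)) i i' *
        (((sqrtAbs (signVec (cmPlaceOver L) (cmGramEntry L e₁ dV hdV (lineW L (TW (↥(maximalRealSubfield L)) a))
          (complexConj_lineW L (TW (↥(maximalRealSubfield L)) a))) (imagUnit L) v₀) i' : ℝ) : ℂ))⁻¹) = (A : Matrix (Fin n') (Fin n') ℂ) i i')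
    (hβII : ∀ (W : Matrix.unitaryGroup (Fin n') ℂ) (β : (Fin n' × {v : InfinitePlace (↥(maximalRealSubfield L)) // v.IsReal}) →₀ ℕ),
      carrierConjEquiv (frameD L e₁ dV hdV hdV0 (lineW L (TW (↥(maximalRealSubfield L)) a)) (complexConj_lineW L (TW (↥(maximalRealSubfield L)) a))
          (lineW_ne_zero L (TW (↥(maximalRealSubfield L)) a) (isUnit_det_TW (↥(maximalRealSubfield L)) a)))
        (unitaryEquivPi (placeBlock (Pi.mulSingle v₀ (reindexUnitary (e₂ (n := n')).symm (blockU (W, 1))))))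
        (schwartzReindexCLM (↥(maximalRealSubfield L)) (e₂ (n := n'))
          (archBoxTensor (follandHermite (frameV L e₁ dV hdV hdV0 (lineW L (TW (↥(maximalRealSubfield L)) a))
              (complexConj_lineW L (TW (↥(maximalRealSubfield L)) a)) (lineW_ne_zero L (TW (↥(maximalRealSubfield L)) a) (isUnit_det_TW (↥(maximalRealSubfield L)) a))) β)
            (gaussianV L e₁ dV hdV hdV0 (lineW L (TW (↥(maximalRealSubfield L)) a)) (complexConj_lineW L (TW (↥(maximalRealSubfield L)) a))
              (lineW_ne_zero L (TW (↥(maximalRealSubfield L)) a) (isUnit_det_TW (↥(maximalRealSubfield L)) a))))) =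
      schwartzReindexCLM (↥(maximalRealSubfield L)) (e₂ (n := n'))
        (archBoxTensor
          (carrierConjEquiv (frameV L e₁ dV hdV hdV0 (lineW L (TW (↥(maximalRealSubfield L)) a)) (complexConj_lineW L (TW (↥(maximalRealSubfield L)) a))
              (lineW_ne_zero L (TW (↥(maximalRealSubfield L)) a) (isUnit_det_TW (↥(maximalRealSubfield L)) a)))
            (unitaryEquivPi (placeBlock (Pi.mulSingle v₀ W)))
            (follandHermite (frameV L e₁ dV hdV hdV0 (lineW L (TW (↥(maximalRealSubfield L)) a))
              (complexConj_lineW L (TW (↥(maximalRealSubfield L)) a)) (lineW_ne_zero L (TW (↥(maximalRealSubfield L)) a) (isUnit_det_TW (↥(maximalRealSubfield L)) a))) β))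
          (gaussianV L e₁ dV hdV hdV0 (lineW L (TW (↥(maximalRealSubfield L)) a)) (complexConj_lineW L (TW (↥(maximalRealSubfield L)) a))
            (lineW_ne_zero L (TW (↥(maximalRealSubfield L)) a) (isUnit_det_TW (↥(maximalRealSubfield L)) a)))))
    (Φf : FinSB (↥(maximalRealSubfield L)) (Fin n')) (φ : 𝓢((Fin n' → mixedEmbedding.mixedSpace ↥(maximalRealSubfield L)), ℂ)) :
    P.space.toSubmodule.starProjection
        (MemLp.toLp _ (F0LD1ThetaTransportKit.memLp_toQuotFun_lineThetaLift L 2 H e₁ dV hdV hdV0 ιA hιA μ hμ a hρ μW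
          (piSchwartzBruhatEquiv (↥(maximalRealSubfield L)) (Fin n') (φ ⊗ₜ Φf)) f μA 2)) = 0 := by
  haveI : Nontrivial (Fin n') := by
    have h3 : Fintype.card (Fin n') = 2 := by
      rw [← Fintype.card_congr e₁, Fintype.card_prod, Fintype.card_fin, Fintype.card_fin]
    rw [Fintype.card_fin] at h3
    subst h3
    infer_instance
  obtain ⟨Tθ, hTθ⟩ := F0LD2ThetaTensorCLM.exists_clm_comp_toLp_lineThetaLift_tmul L 2 H e₁ dV hdV hdV0 ιA hιA μ hμ a hρ μW f μA
    P.space.toSubmodule.starProjection Φf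
  set eV := frameV L e₁ dV hdV hdV0 (lineW L (TW (↥(maximalRealSubfield L)) a)) (complexConj_lineW L (TW (↥(maximalRealSubfield L)) a))
    (lineW_ne_zero L (TW (↥(maximalRealSubfield L)) a) (isUnit_det_TW (↥(maximalRealSubfield L)) a)) with heV
  let T' : SchwartzMap ((Fin n' × {v : InfinitePlace (↥(maximalRealSubfield L)) // v.IsReal}) → ℝ) ℂ →L[ℂ] Lp ℂ 2 μA :=
    Tθ.comp ((schwartzTransport eV).symm : _ ≃L[ℂ] _).toContinuousLinearMap
  have hT'apply : ∀ ψ, T' ψ = Tθ ((schwartzTransport eV).symm ψ) := fun ψ => rfl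
  have hne : piSchwartzBruhatEquiv (↥(maximalRealSubfield L)) (Fin n')
      (gaussianV L e₁ dV hdV hdV0 (lineW L (TW (↥(maximalRealSubfield L)) a)) (complexConj_lineW L (TW (↥(maximalRealSubfield L)) a))
        (lineW_ne_zero L (TW (↥(maximalRealSubfield L)) a) (isUnit_det_TW (↥(maximalRealSubfield L)) a)) ⊗ₜ Φf) ≠ 0 ∨ Φf = 0 := by
    by_cases hf : Φf = 0
    · exact Or.inr hf
    · exact Or.inl (piSchwartzBruhatEquiv_tmul_ne_zero (gaussianV_ne_zero L e₁ dV hdV hdV0 _ _ _) hf)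
  rcases hne with hne | hf
  swap
  · -- `Φ_f = 0`: the class is the class of `0`
    subst hf
    rw [TensorProduct.tmul_zero, map_zero, ← zero_smul ℂ (0 : piSchwartzBruhat (↥(maximalRealSubfield L)) (Fin n')),
      F0LD2ThetaTensorClasses.toLp_lineThetaLift_smul_left L 2 H e₁ dV hdV hdV0 ιA hιA μ hμ a hρ μW f μA, zero_smul, map_zero]
  have hcov : ∀ (A : Matrix.unitaryGroup (Fin n') ℂ) (β : (Fin n' × {v : InfinitePlace (↥(maximalRealSubfield L)) // v.IsReal}) →₀ ℕ),
      T' (unitaryOpPi (placeBlock (Pi.mulSingle v₀ A)) (hermitePi β)) =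
        ((A : Matrix (Fin n') (Fin n') ℂ).det ^ ((τ (cmPlaceOver L v₀).1 + 1) / 2)) • T' (hermitePi β) := by
    intro A β
    obtain ⟨u, hu⟩ := hS1 A
    obtain ⟨W, hW, hsec⟩ := exists_sectionD_archKPlace_apply_of_pos L e₁ dV hdV hdV0 (lineW L (TW (↥(maximalRealSubfield L)) a))
      (complexConj_lineW L (TW (↥(maximalRealSubfield L)) a)) (lineW_ne_zero L (TW (↥(maximalRealSubfield L)) a) (isUnit_det_TW (↥(maximalRealSubfield L)) a))
      v₀ u hpos
    have hWA : W = A := Subtype.ext (Matrix.ext fun i i' => (hW i i').trans (hu i i'))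
    subst hWA
    have hS := hβII W β
    have hbox : carrierConjEquiv (frameD L e₁ dV hdV hdV0 (lineW L (TW (↥(maximalRealSubfield L)) a)) (complexConj_lineW L (TW (↥(maximalRealSubfield L)) a))
          (lineW_ne_zero L (TW (↥(maximalRealSubfield L)) a) (isUnit_det_TW (↥(maximalRealSubfield L)) a)))
        (sectionD L e₁ dV hdV hdV0 (lineW L (TW (↥(maximalRealSubfield L)) a)) (complexConj_lineW L (TW (↥(maximalRealSubfield L)) a))
          (lineW_ne_zero L (TW (↥(maximalRealSubfield L)) a) (isUnit_det_TW (↥(maximalRealSubfield L)) a))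
          (archKPlace L e₁ dV hdV (lineW L (TW (↥(maximalRealSubfield L)) a)) (complexConj_lineW L (TW (↥(maximalRealSubfield L)) a)) v₀ u)).1.2
          (schwartzReindexCLM (↥(maximalRealSubfield L)) (e₂ (n := n'))
            (archBoxTensor (follandHermite eV β)
              (gaussianV L e₁ dV hdV hdV0 (lineW L (TW (↥(maximalRealSubfield L)) a)) (complexConj_lineW L (TW (↥(maximalRealSubfield L)) a))
                (lineW_ne_zero L (TW (↥(maximalRealSubfield L)) a) (isUnit_det_TW (↥(maximalRealSubfield L)) a))))) =
        MpS.vac (sectionD L e₁ dV hdV hdV0 (lineW L (TW (↥(maximalRealSubfield L)) a)) (complexConj_lineW L (TW (↥(maximalRealSubfield L)) a))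
            (lineW_ne_zero L (TW (↥(maximalRealSubfield L)) a) (isUnit_det_TW (↥(maximalRealSubfield L)) a))
            (archKPlace L e₁ dV hdV (lineW L (TW (↥(maximalRealSubfield L)) a)) (complexConj_lineW L (TW (↥(maximalRealSubfield L)) a)) v₀ u)) •
          schwartzReindexCLM (↥(maximalRealSubfield L)) (e₂ (n := n'))
            (archBoxTensor (carrierConjEquiv eV (unitaryEquivPi (placeBlock (Pi.mulSingle v₀ W))) (follandHermite eV β))
              (gaussianV L e₁ dV hdV hdV0 (lineW L (TW (↥(maximalRealSubfield L)) a)) (complexConj_lineW L (TW (↥(maximalRealSubfield L)) a))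
                (lineW_ne_zero L (TW (↥(maximalRealSubfield L)) a) (isUnit_det_TW (↥(maximalRealSubfield L)) a)))) := by
      rw [heV, ← hS, carrierConjEquiv_apply, carrierConjEquiv_apply, hsec, map_smul, unitaryEquivPi_apply]
    have hvac : MpS.vac (sectionD L e₁ dV hdV hdV0 (lineW L (TW (↥(maximalRealSubfield L)) a)) (complexConj_lineW L (TW (↥(maximalRealSubfield L)) a))
        (lineW_ne_zero L (TW (↥(maximalRealSubfield L)) a) (isUnit_det_TW (↥(maximalRealSubfield L)) a))
        (archKPlace L e₁ dV hdV (lineW L (TW (↥(maximalRealSubfield L)) a)) (complexConj_lineW L (TW (↥(maximalRealSubfield L)) a)) v₀ u)) ≠ 0 :=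
      MpS.vac_ne_zero _
    have hcov₁ := starProjection_toLp_lineThetaLift_tmul_of_box₂ L H e₁ dV hdV hdV0 t ht g hg ιA hιA hpin μ hμ a hρ μW f w₁ 𝔣 P hfh hj hjmem hjne v₀ hw₀ hτ hodd u
      hvac hbox Φf hne
    rw [etaD_mul_vac_archKPlace_of_pos L e₁ dV hdV hdV0 _ _ _ v₀ τ u hpos, pow_one] at hcov₁
    have hdetW : ((W : Matrix.unitaryGroup (Fin n') ℂ) : Matrix (Fin n') (Fin n') ℂ).det =
        star (((u : UnitaryGroup.archLocal L 2 (Matrix.diagonal dV) (cmPlaceOver L v₀)) : GL (Fin 2) ℂ) : Matrix (Fin 2) (Fin 2) ℂ).det := by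
      rw [det_eq_star_pow_of_entries e₁ (W : Matrix (Fin n') (Fin n') ℂ)
        (sqrtAbs_signVec_ne_zero (IsCMField.complexConj_ne_one L) (cmPlaceOver_smul L) (complexConj_imagUnit L) (imagUnit_ne_zero L)
          (cmGramEntry_ne_zero L e₁ dV hdV _ _ hdV0 (lineW_ne_zero L (TW (↥(maximalRealSubfield L)) a) (isUnit_det_TW (↥(maximalRealSubfield L)) a))) v₀)
        _ hW, pow_one]
    have hinv : ((((u : UnitaryGroup.archLocal L 2 (Matrix.diagonal dV) (cmPlaceOver L v₀)) : GL (Fin 2) ℂ) : Matrix (Fin 2) (Fin 2) ℂ).det ^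
        ((τ (cmPlaceOver L v₀).1 + 1) / 2))⁻¹ = ((W : Matrix.unitaryGroup (Fin n') ℂ) : Matrix (Fin n') (Fin n') ℂ).det ^ ((τ (cmPlaceOver L v₀).1 + 1) / 2) := by
      rw [hdetW, ← inv_zpow]
      congr 1
      exact inv_eq_of_mul_eq_one_left (star_det_mul_det_eq_one_of_mem_archLocal L dV hdV0 (cmPlaceOver L v₀) u)
    rw [hinv] at hcov₁
    rw [hT'apply, hT'apply, hTθ, hTθ]
    have h1 : (schwartzTransport eV).symm (unitaryOpPi (placeBlock (Pi.mulSingle v₀ W)) (hermitePi β)) =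
        carrierConjEquiv eV (unitaryEquivPi (placeBlock (Pi.mulSingle v₀ W))) (follandHermite eV β) := by
      rw [carrierConjEquiv_apply, follandHermite, ContinuousLinearEquiv.apply_symm_apply, unitaryEquivPi_apply]
    have h2 : (schwartzTransport eV).symm (hermitePi β) = follandHermite eV β := rfl
    rw [h1, h2]
    exact hcov₁
  have hT'0 : T' = 0 := eq_zero_of_forall_unitaryOpPi_placeBlock_mulSingle_hermitePi v₀ T' hm hcov
  have hφ : Tθ φ = T' (schwartzTransport eV φ) := by rw [hT'apply, ContinuousLinearEquiv.symm_apply_apply]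
  rw [← hTθ, hφ, hT'0]
  rfl

include ht hg hpin hfh hjmem hjne in
set_option maxHeartbeats 1600000 in -- (as ★ n = 3: the telescope of ★ α ∕ ★ T3 is large; the rewrites are cheap but numerous)
/-- **THE PROJECTED THETA FUNCTIONAL VANISHES ON PURE TENSORS WHEN THE ARCHIMEDEAN EXPONENT IS WRONG, pair form NEGATIVE at `v₀`**
(`(1−τ_{w₀})/2 ≠ 0`; `W_u` carries no conjugate, `det W_u = det u`; modulo `hS1`, `hβII`).
[cite: Liu2021, proof of Prop. 4.13 Case 1 (l. 2137–2141, p. 48); App. D Lem. D.2 (1)] [cite: KonnoKonno2007, Thm. 5.4, Lemma 5.2] [cite: Folland1989, Prop. (4.76)] -/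
theorem starProjection_toLp_lineThetaLift_tmul_eq_zero_of_neg₂ (hw₀ : cmPlaceOver L v₀ ≠ w₁)
    {τ : InfinitePlace L → ℤ} (hτ : (toHeckeCharacter L μ).HasUnitaryArchType τ 0) (hodd : ∀ w, Odd (τ w))
    (hneg : ∀ k : Fin n', ¬ 0 < signVec (cmPlaceOver L) (cmGramEntry L e₁ dV hdV (lineW L (TW (↥(maximalRealSubfield L)) a))
      (complexConj_lineW L (TW (↥(maximalRealSubfield L)) a))) (imagUnit L) v₀ k)
    (hm : (1 - τ (cmPlaceOver L v₀).1) / 2 ≠ 0)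
    (hS1 : ∀ A : Matrix.unitaryGroup (Fin n') ℂ, ∃ u : UnitaryGroup.archLocal L 2 (Matrix.diagonal dV) (cmPlaceOver L v₀),
      ∀ i i' : Fin n', (((sqrtAbs (signVec (cmPlaceOver L) (cmGramEntry L e₁ dV hdV (lineW L (TW (↥(maximalRealSubfield L)) a))
          (complexConj_lineW L (TW (↥(maximalRealSubfield L)) a))) (imagUnit L) v₀) i : ℝ) : ℂ)) *
        Matrix.reindex e₁ e₁
          ((((u : UnitaryGroup.archLocal L 2 (Matrix.diagonal dV) (cmPlaceOver L v₀)) : GL (Fin 2) ℂ) : Matrix (Fin 2) (Fin 2) ℂ) ⊗ₖ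
            (1 : Matrix (Fin 1) (Fin 1) ℂ)) i i' *
        (((sqrtAbs (signVec (cmPlaceOver L) (cmGramEntry L e₁ dV hdV (lineW L (TW (↥(maximalRealSubfield L)) a))
          (complexConj_lineW L (TW (↥(maximalRealSubfield L)) a))) (imagUnit L) v₀) i' : ℝ) : ℂ))⁻¹ = (A : Matrix (Fin n') (Fin n') ℂ) i i')
    (hβII : ∀ (W : Matrix.unitaryGroup (Fin n') ℂ) (β : (Fin n' × {v : InfinitePlace (↥(maximalRealSubfield L)) // v.IsReal}) →₀ ℕ),
      carrierConjEquiv (frameD L e₁ dV hdV hdV0 (lineW L (TW (↥(maximalRealSubfield L)) a)) (complexConj_lineW L (TW (↥(maximalRealSubfield L)) a))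
          (lineW_ne_zero L (TW (↥(maximalRealSubfield L)) a) (isUnit_det_TW (↥(maximalRealSubfield L)) a)))
        (unitaryEquivPi (placeBlock (Pi.mulSingle v₀ (reindexUnitary (e₂ (n := n')).symm (blockU (W, 1))))))
        (schwartzReindexCLM (↥(maximalRealSubfield L)) (e₂ (n := n'))
          (archBoxTensor (follandHermite (frameV L e₁ dV hdV hdV0 (lineW L (TW (↥(maximalRealSubfield L)) a))
              (complexConj_lineW L (TW (↥(maximalRealSubfield L)) a)) (lineW_ne_zero L (TW (↥(maximalRealSubfield L)) a) (isUnit_det_TW (↥(maximalRealSubfield L)) a))) β)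
            (gaussianV L e₁ dV hdV hdV0 (lineW L (TW (↥(maximalRealSubfield L)) a)) (complexConj_lineW L (TW (↥(maximalRealSubfield L)) a))
              (lineW_ne_zero L (TW (↥(maximalRealSubfield L)) a) (isUnit_det_TW (↥(maximalRealSubfield L)) a))))) =
      schwartzReindexCLM (↥(maximalRealSubfield L)) (e₂ (n := n'))
        (archBoxTensor
          (carrierConjEquiv (frameV L e₁ dV hdV hdV0 (lineW L (TW (↥(maximalRealSubfield L)) a)) (complexConj_lineW L (TW (↥(maximalRealSubfield L)) a))
              (lineW_ne_zero L (TW (↥(maximalRealSubfield L)) a) (isUnit_det_TW (↥(maximalRealSubfield L)) a)))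
            (unitaryEquivPi (placeBlock (Pi.mulSingle v₀ W)))
            (follandHermite (frameV L e₁ dV hdV hdV0 (lineW L (TW (↥(maximalRealSubfield L)) a))
              (complexConj_lineW L (TW (↥(maximalRealSubfield L)) a)) (lineW_ne_zero L (TW (↥(maximalRealSubfield L)) a) (isUnit_det_TW (↥(maximalRealSubfield L)) a))) β))
          (gaussianV L e₁ dV hdV hdV0 (lineW L (TW (↥(maximalRealSubfield L)) a)) (complexConj_lineW L (TW (↥(maximalRealSubfield L)) a))
            (lineW_ne_zero L (TW (↥(maximalRealSubfield L)) a) (isUnit_det_TW (↥(maximalRealSubfield L)) a)))))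
    (Φf : FinSB (↥(maximalRealSubfield L)) (Fin n')) (φ : 𝓢((Fin n' → mixedEmbedding.mixedSpace ↥(maximalRealSubfield L)), ℂ)) :
    P.space.toSubmodule.starProjection
        (MemLp.toLp _ (F0LD1ThetaTransportKit.memLp_toQuotFun_lineThetaLift L 2 H e₁ dV hdV hdV0 ιA hιA μ hμ a hρ μW
          (piSchwartzBruhatEquiv (↥(maximalRealSubfield L)) (Fin n') (φ ⊗ₜ Φf)) f μA 2)) = 0 := by
  haveI : Nontrivial (Fin n') := by
    have h3 : Fintype.card (Fin n') = 2 := by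
      rw [← Fintype.card_congr e₁, Fintype.card_prod, Fintype.card_fin, Fintype.card_fin]
    rw [Fintype.card_fin] at h3
    subst h3
    infer_instance
  obtain ⟨Tθ, hTθ⟩ := F0LD2ThetaTensorCLM.exists_clm_comp_toLp_lineThetaLift_tmul L 2 H e₁ dV hdV hdV0 ιA hιA μ hμ a hρ μW f μA
    P.space.toSubmodule.starProjection Φf
  set eV := frameV L e₁ dV hdV hdV0 (lineW L (TW (↥(maximalRealSubfield L)) a)) (complexConj_lineW L (TW (↥(maximalRealSubfield L)) a))
    (lineW_ne_zero L (TW (↥(maximalRealSubfield L)) a) (isUnit_det_TW (↥(maximalRealSubfield L)) a)) with heV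
  let T' : SchwartzMap ((Fin n' × {v : InfinitePlace (↥(maximalRealSubfield L)) // v.IsReal}) → ℝ) ℂ →L[ℂ] Lp ℂ 2 μA :=
    Tθ.comp ((schwartzTransport eV).symm : _ ≃L[ℂ] _).toContinuousLinearMap
  have hT'apply : ∀ ψ, T' ψ = Tθ ((schwartzTransport eV).symm ψ) := fun ψ => rfl
  have hne : piSchwartzBruhatEquiv (↥(maximalRealSubfield L)) (Fin n')
      (gaussianV L e₁ dV hdV hdV0 (lineW L (TW (↥(maximalRealSubfield L)) a)) (complexConj_lineW L (TW (↥(maximalRealSubfield L)) a))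
        (lineW_ne_zero L (TW (↥(maximalRealSubfield L)) a) (isUnit_det_TW (↥(maximalRealSubfield L)) a)) ⊗ₜ Φf) ≠ 0 ∨ Φf = 0 := by
    by_cases hf : Φf = 0
    · exact Or.inr hf
    · exact Or.inl (piSchwartzBruhatEquiv_tmul_ne_zero (gaussianV_ne_zero L e₁ dV hdV hdV0 _ _ _) hf)
  rcases hne with hne | hf
  swap
  · -- `Φ_f = 0`: the class is the class of `0`
    subst hf
    rw [TensorProduct.tmul_zero, map_zero, ← zero_smul ℂ (0 : piSchwartzBruhat (↥(maximalRealSubfield L)) (Fin n')),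
      F0LD2ThetaTensorClasses.toLp_lineThetaLift_smul_left L 2 H e₁ dV hdV hdV0 ιA hιA μ hμ a hρ μW f μA, zero_smul, map_zero]
  have hcov : ∀ (A : Matrix.unitaryGroup (Fin n') ℂ) (β : (Fin n' × {v : InfinitePlace (↥(maximalRealSubfield L)) // v.IsReal}) →₀ ℕ),
      T' (unitaryOpPi (placeBlock (Pi.mulSingle v₀ A)) (hermitePi β)) =
        ((A : Matrix (Fin n') (Fin n') ℂ).det ^ ((1 - τ (cmPlaceOver L v₀).1) / 2)) • T' (hermitePi β) := by
    intro A β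
    obtain ⟨u, hu⟩ := hS1 A
    obtain ⟨W, hW, hsec⟩ := exists_sectionD_archKPlace_apply_of_neg L e₁ dV hdV hdV0 (lineW L (TW (↥(maximalRealSubfield L)) a))
      (complexConj_lineW L (TW (↥(maximalRealSubfield L)) a)) (lineW_ne_zero L (TW (↥(maximalRealSubfield L)) a) (isUnit_det_TW (↥(maximalRealSubfield L)) a))
      v₀ u hneg
    have hWA : W = A := Subtype.ext (Matrix.ext fun i i' => (hW i i').trans (hu i i'))
    subst hWA
    have hS := hβII W β
    have hbox : carrierConjEquiv (frameD L e₁ dV hdV hdV0 (lineW L (TW (↥(maximalRealSubfield L)) a)) (complexConj_lineW L (TW (↥(maximalRealSubfield L)) a))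
          (lineW_ne_zero L (TW (↥(maximalRealSubfield L)) a) (isUnit_det_TW (↥(maximalRealSubfield L)) a)))
        (sectionD L e₁ dV hdV hdV0 (lineW L (TW (↥(maximalRealSubfield L)) a)) (complexConj_lineW L (TW (↥(maximalRealSubfield L)) a))
          (lineW_ne_zero L (TW (↥(maximalRealSubfield L)) a) (isUnit_det_TW (↥(maximalRealSubfield L)) a))
          (archKPlace L e₁ dV hdV (lineW L (TW (↥(maximalRealSubfield L)) a)) (complexConj_lineW L (TW (↥(maximalRealSubfield L)) a)) v₀ u)).1.2
          (schwartzReindexCLM (↥(maximalRealSubfield L)) (e₂ (n := n'))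
            (archBoxTensor (follandHermite eV β)
              (gaussianV L e₁ dV hdV hdV0 (lineW L (TW (↥(maximalRealSubfield L)) a)) (complexConj_lineW L (TW (↥(maximalRealSubfield L)) a))
                (lineW_ne_zero L (TW (↥(maximalRealSubfield L)) a) (isUnit_det_TW (↥(maximalRealSubfield L)) a))))) =
        MpS.vac (sectionD L e₁ dV hdV hdV0 (lineW L (TW (↥(maximalRealSubfield L)) a)) (complexConj_lineW L (TW (↥(maximalRealSubfield L)) a))
            (lineW_ne_zero L (TW (↥(maximalRealSubfield L)) a) (isUnit_det_TW (↥(maximalRealSubfield L)) a))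
            (archKPlace L e₁ dV hdV (lineW L (TW (↥(maximalRealSubfield L)) a)) (complexConj_lineW L (TW (↥(maximalRealSubfield L)) a)) v₀ u)) •
          schwartzReindexCLM (↥(maximalRealSubfield L)) (e₂ (n := n'))
            (archBoxTensor (carrierConjEquiv eV (unitaryEquivPi (placeBlock (Pi.mulSingle v₀ W))) (follandHermite eV β))
              (gaussianV L e₁ dV hdV hdV0 (lineW L (TW (↥(maximalRealSubfield L)) a)) (complexConj_lineW L (TW (↥(maximalRealSubfield L)) a))
                (lineW_ne_zero L (TW (↥(maximalRealSubfield L)) a) (isUnit_det_TW (↥(maximalRealSubfield L)) a)))) := by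
      rw [heV, ← hS, carrierConjEquiv_apply, carrierConjEquiv_apply, hsec, map_smul, unitaryEquivPi_apply]
    have hvac : MpS.vac (sectionD L e₁ dV hdV hdV0 (lineW L (TW (↥(maximalRealSubfield L)) a)) (complexConj_lineW L (TW (↥(maximalRealSubfield L)) a))
        (lineW_ne_zero L (TW (↥(maximalRealSubfield L)) a) (isUnit_det_TW (↥(maximalRealSubfield L)) a))
        (archKPlace L e₁ dV hdV (lineW L (TW (↥(maximalRealSubfield L)) a)) (complexConj_lineW L (TW (↥(maximalRealSubfield L)) a)) v₀ u)) ≠ 0 :=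
      MpS.vac_ne_zero _
    have hcov₁ := starProjection_toLp_lineThetaLift_tmul_of_box₂ L H e₁ dV hdV hdV0 t ht g hg ιA hιA hpin μ hμ a hρ μW f w₁ 𝔣 P hfh hj hjmem hjne v₀ hw₀ hτ hodd u
      hvac hbox Φf hne
    rw [etaD_mul_vac_archKPlace_of_neg L e₁ dV hdV hdV0 _ _ _ v₀ hodd u hneg, pow_one] at hcov₁
    have hdetW : ((W : Matrix.unitaryGroup (Fin n') ℂ) : Matrix (Fin n') (Fin n') ℂ).det =
        (((u : UnitaryGroup.archLocal L 2 (Matrix.diagonal dV) (cmPlaceOver L v₀)) : GL (Fin 2) ℂ) : Matrix (Fin 2) (Fin 2) ℂ).det := by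
      rw [det_eq_pow_of_entries e₁ (W : Matrix (Fin n') (Fin n') ℂ)
        (sqrtAbs_signVec_ne_zero (IsCMField.complexConj_ne_one L) (cmPlaceOver_smul L) (complexConj_imagUnit L) (imagUnit_ne_zero L)
          (cmGramEntry_ne_zero L e₁ dV hdV _ _ hdV0 (lineW_ne_zero L (TW (↥(maximalRealSubfield L)) a) (isUnit_det_TW (↥(maximalRealSubfield L)) a))) v₀)
        _ hW, pow_one]
    have hdet0 : (((u : UnitaryGroup.archLocal L 2 (Matrix.diagonal dV) (cmPlaceOver L v₀)) : GL (Fin 2) ℂ) : Matrix (Fin 2) (Fin 2) ℂ).det ≠ 0 :=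
      (((u : UnitaryGroup.archLocal L 2 (Matrix.diagonal dV) (cmPlaceOver L v₀)) : GL (Fin 2) ℂ).isUnit.map Matrix.detMonoidHom).ne_zero
    have hinv : ((((u : UnitaryGroup.archLocal L 2 (Matrix.diagonal dV) (cmPlaceOver L v₀)) : GL (Fin 2) ℂ) : Matrix (Fin 2) (Fin 2) ℂ).det ^
        ((τ (cmPlaceOver L v₀).1 - 1) / 2))⁻¹ = ((W : Matrix.unitaryGroup (Fin n') ℂ) : Matrix (Fin n') (Fin n') ℂ).det ^ ((1 - τ (cmPlaceOver L v₀).1) / 2) := by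
      rw [hdetW, ← zpow_neg]
      congr 1
      obtain ⟨m, hm'⟩ := hodd (cmPlaceOver L v₀).1
      omega
    rw [hinv] at hcov₁
    rw [hT'apply, hT'apply, hTθ, hTθ]
    have h1 : (schwartzTransport eV).symm (unitaryOpPi (placeBlock (Pi.mulSingle v₀ W)) (hermitePi β)) =
        carrierConjEquiv eV (unitaryEquivPi (placeBlock (Pi.mulSingle v₀ W))) (follandHermite eV β) := by
      rw [carrierConjEquiv_apply, follandHermite, ContinuousLinearEquiv.apply_symm_apply, unitaryEquivPi_apply]
    have h2 : (schwartzTransport eV).symm (hermitePi β) = follandHermite eV β := rfl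
    rw [h1, h2]
    exact hcov₁
  have hT'0 : T' = 0 := eq_zero_of_forall_unitaryOpPi_placeBlock_mulSingle_hermitePi v₀ T' hm hcov
  have hφ : Tθ φ = T' (schwartzTransport eV φ) := by rw [hT'apply, ContinuousLinearEquiv.symm_apply_apply]
  rw [← hTθ, hφ, hT'0]
  rfl

end Core

end Summit.HodgeConjecture.HodgeConjecture.Cruxes.HLiu418.F0LD2ArchTypeAwayCore
end
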